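import Literature.Probability.LatticeModels.ClusterExpansion

/-!
# `BalabanImbrieJaffe1984to88.BIJ88ObservableGas312` — T. Bałaban, J. Imbrie, A. Jaffe, *Effective action and cluster properties of
the abelian Higgs model*, Commun. Math. Phys. **114** (1988) 257–315 [BalabanImbrieJaffe1988]: Sect. 5.14, p. 312 [PDF 56] — the
OBSERVABLE-CARRYING POLYMER GAS and the step *"Finally the polymer expansion u = 1 + a permits us to factor out the normalization"*,
realized by the Kotecký–Preiss ratio formula of the tree (`LatticeModels.polymerPartitionFunction_sdiff_div_eq_exp`).

HONEST FRAMING (cell `lit-balaban`, verbatim): statement-level skeleton of published theorems with citation tags; proofs where landed; nothing here is a claim about the Yang–Mills mass gap.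

PDF held: `paper:balaban1988-cmp114-bij-abelian-higgs-effective-action` (journal page = PDF page + 256); p. 309 = PDF p. 53, p. 310 = PDF p. 54,
p. 312 = PDF p. 56 (renders `renders/original-p053…p056-x2.png` in the seat folder, made with `b2b-balaban-ref1/tools/g4png.py`).

CITATION HEADER (verbatim).  p. 312 [PDF 56]: *"Having extracted the desired perturbative terms F^L_{k+1,loc}(X_c), we need to finish the
calculation of the remainders by giving a cluster expansion for ⟨Π_r F_{k,rem}(X_r)⟩₁, with appropriate bounds. We use essentially the same
expansion as before, Mayer-expanding V^{(k)}(Y)'s and interpolating the Gaussian measure. Finally the polymer expansion u = 1 + a permits us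
to factor out the normalization. Without going into details, it is clear that the result can be written in the following form:
⟨Π_{σ₁} F^{m̄}_{k,loc}(X_{σ₁})⟩₁ = Σ_{{X_{r′}}} Π_{r′} G_k(X_{r′}) Π_{c: X_c⊄∪_{r′}X_{r′}} F^L_{k+1,loc}(X_c). The X_{r′} are disjoint, and each
one covers at least one X_{σ₁}, the support of one of the observables F^{m̄}_{k,loc}."*  p. 309 [PDF 53] (the *"same expansion as before"*):
*"Denote the X_β's with H_β ≠ ∅ by X_γ; the X_β with H_β = ∅ by Y_δ. The expansion (5.14.2) becomes … Σ_{{X_γ},{Y_δ} nonoverlapping}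
Π_γ g₃(H_γ, X_γ) Π_δ g₃(∅, Y_δ). Each X_γ must cover and connect all the t-derivatives specified by H_γ. Next we reorganize this expansion
… We insert factors u(X_γ, Y_δ) = 1 if X, Y do not overlap, 0 if X, Y overlap, … We put u = 1 + a and expand in the usual manner. This
enables us to factor out the normalization z_t(Λ₁₂^{(k)})"*.

WHAT IS REPRODUCED (unit `lit-balaban-p25`, generation 11 of the Phase-2 proof seat p25; SKELETON row `C2.Claim@312` (second display of
p. 312) — this file is step 1 of its derivation, files `BIJ88ClusterSupports312`, `BIJ88SupportRegrouping312`, `BIJ88ObservableFactorization312`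
continue; HOME `run/shared/lean/pub/lit-balaban/lit-balaban-p25/`).  Everything is stated for an ABSTRACT polymer gas in the vocabulary of
`Literature.Probability.LatticeModels.PolymerGas` / `.ClusterExpansion`: vacuum polymers `P` (the `Y_δ`, activities `w` = `g₃(∅,·)` resp. the
prime-dropped `g′`) with incompatibility `inc` (overlap), a finite volume `Λ : Finset P` (the polymers inside `Λ₁₂^{(k)}`), and
OBSERVABLE-CARRYING (decorated) polymers `Q` (the `X_γ` together with the observables `F_{k,rem}(X_r)` / t-derivatives they carry, activities
`wQ` = `g₃(H_γ,·)`) with their incompatibility `incQ X Y` (*"X, Y overlap"*) towards vacuum polymers; the admissible decorated families (pairwise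
non-overlapping, carrying every observable exactly once, …) form an arbitrary finite family `𝒟` here and are made concrete in
`BIJ88ObservableFactorization312`.
§1 `avoid`/`nbhd` (the vacuum polymers compatible with / overlapping a decorated family; `avoid = Λ ∖ nbhd`), `obsNumerator` (the un-normalized
  expectation with the observables inserted = the mixed sum Σ_{{X_γ},{Y_δ} nonoverlapping} Π g₃(H_γ,X_γ) Π g₃(∅,Y_δ) of p. 309),
  `obsNumerator_eq_sum_mul` (= Σ_D Π wQ · Z(Λ ∖ N(D)) — the vacuum gas re-summed around each decorated family).
§2 `obsRatio_eq_sum_mul_exp` — *"factor out the normalization"*: in a Kotecký–Preiss volume, `obsNumerator / Z(Λ) = Σ_{D ∈ 𝒟} Π_{X∈D} wQ X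
  · exp(−Σ_{C ⊆ Λ, C overlapping D} Φ^T(C))` (the tree's [KP86, (5)] `polymerPartitionFunction_sdiff_div_eq_exp`); `obsRatio_eq_sum_mul_exp_clusters`
  (only clusters contribute, `truncatedWeight_eq_zero_of_kp`).
HONEST SCOPE: finite identities of complex numbers given the KP hypothesis `IsKPVolume inc w a Λ` on the vacuum gas (the printed input *"It is now
a standard exercise to estimate the expansion, using (5.14.4)"*, p. 310; derived for the honest §5.13 gas from an activity bound in
`BIJ88TypedGasKP.isKPVolume_typedGas`); nothing analytic about the activities is asserted; 0 `sorry`, 0 new `Prop` facts (D-0026).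
-/

noncomputable section

open Finset
open Literature.Probability.LatticeModels

namespace Literature.MathematicalPhysics.QuantumFieldTheory.BalabanImbrieJaffe1984to88.BIJ88ObservableGas312

variable {P : Type*} [DecidableEq P] {Q : Type*}
variable (inc : P → P → Prop) [DecidableRel inc] (incQ : Q → P → Prop) [∀ X Y, Decidable (incQ X Y)]

/-! ## §1 The observable-carrying gas: decorated families and the vacuum polymers around them -/

/-- p. 309/310 [PDF 53/54]: *"u(X_γ, Y_δ) = 1 if X, Y do not overlap, 0 if X, Y overlap"* — the vacuum polymers of the volume `Λ` compatible with
(not overlapping) every member of the decorated family `D`: `Λ ∖ N(D)`. [cite: BalabanImbrieJaffe1988, (5.14.5) p.312] -/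
def avoid (Λ : Finset P) (D : Finset Q) : Finset P := Λ.filter fun Y => ∀ X ∈ D, ¬ incQ X Y

/-- the vacuum polymers of `Λ` overlapping some member of the decorated family `D`: `N(D) ∩ Λ`. [cite: BalabanImbrieJaffe1988, (5.14.5) p.312] -/
def nbhd (Λ : Finset P) (D : Finset Q) : Finset P := Λ.filter fun Y => ∃ X ∈ D, incQ X Y

variable {inc incQ}

omit [DecidableEq P] in
/-- membership in `avoid`. [cite: BalabanImbrieJaffe1988, (5.14.5) p.312] -/
theorem mem_avoid {Λ : Finset P} {D : Finset Q} {Y : P} : Y ∈ avoid incQ Λ D ↔ Y ∈ Λ ∧ ∀ X ∈ D, ¬ incQ X Y := mem_filter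

omit [DecidableEq P] in
/-- membership in `nbhd`. [cite: BalabanImbrieJaffe1988, (5.14.5) p.312] -/
theorem mem_nbhd {Λ : Finset P} {D : Finset Q} {Y : P} : Y ∈ nbhd incQ Λ D ↔ Y ∈ Λ ∧ ∃ X ∈ D, incQ X Y := mem_filter

/-- `avoid = Λ ∖ nbhd`. [cite: BalabanImbrieJaffe1988, (5.14.5) p.312] -/
theorem avoid_eq_sdiff (Λ : Finset P) (D : Finset Q) : avoid incQ Λ D = Λ \ nbhd incQ Λ D := by
  ext Y
  simp only [mem_avoid, mem_sdiff, mem_nbhd, not_and, not_exists]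
  exact ⟨fun h => ⟨h.1, fun _ => h.2⟩, fun h => ⟨h.1, h.2 h.1⟩⟩

omit [DecidableEq P] in
/-- `avoid ⊆ Λ`. [cite: BalabanImbrieJaffe1988, (5.14.5) p.312] -/
theorem avoid_subset (Λ : Finset P) (D : Finset Q) : avoid incQ Λ D ⊆ Λ := filter_subset _ _

omit [DecidableEq P] in
/-- `nbhd ⊆ Λ`. [cite: BalabanImbrieJaffe1988, (5.14.5) p.312] -/
theorem nbhd_subset (Λ : Finset P) (D : Finset Q) : nbhd incQ Λ D ⊆ Λ := filter_subset _ _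

omit [DecidableEq P] in
/-- no decorated polymers: nothing is excluded. [cite: BalabanImbrieJaffe1988, (5.14.5) p.312] -/
@[simp] theorem avoid_empty (Λ : Finset P) : avoid incQ Λ (∅ : Finset Q) = Λ := by
  ext Y; simp [mem_avoid]

omit [DecidableEq P] in
/-- `nbhd` is monotone in the decorated family. [cite: BalabanImbrieJaffe1988, (5.14.5) p.312] -/
theorem nbhd_mono (Λ : Finset P) {D D' : Finset Q} (h : D ⊆ D') : nbhd incQ Λ D ⊆ nbhd incQ Λ D' := by
  intro Y hY
  obtain ⟨hYΛ, X, hX, hXY⟩ := mem_nbhd.1 hY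
  exact mem_nbhd.2 ⟨hYΛ, X, h hX, hXY⟩

/-- `nbhd` of a union. [cite: BalabanImbrieJaffe1988, (5.14.5) p.312] -/
theorem nbhd_union [DecidableEq Q] (Λ : Finset P) (D D' : Finset Q) :
    nbhd incQ Λ (D ∪ D') = nbhd incQ Λ D ∪ nbhd incQ Λ D' := by
  ext Y
  simp only [mem_nbhd, mem_union]
  constructor
  · rintro ⟨hY, X, hX | hX, hXY⟩
    · exact Or.inl ⟨hY, X, hX, hXY⟩
    · exact Or.inr ⟨hY, X, hX, hXY⟩
  · rintro (⟨hY, X, hX, hXY⟩ | ⟨hY, X, hX, hXY⟩)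
    · exact ⟨hY, X, Or.inl hX, hXY⟩
    · exact ⟨hY, X, Or.inr hX, hXY⟩

variable (inc incQ)

/-- **The observable-carrying gas** (p. 309 [PDF 53] *"Σ_{{X_γ},{Y_δ} nonoverlapping} Π_γ g₃(H_γ, X_γ) Π_δ g₃(∅, Y_δ)"*, p. 312 [PDF 56] *"a
cluster expansion for ⟨Π_r F_{k,rem}(X_r)⟩₁"*): the un-normalized expectation with the observables inserted — the sum over the admissible
decorated families `D ∈ 𝒟` (the `{X_γ}`, each carrying its observables, activities `wQ`) and the compatible families `A ⊆ Λ` of vacuum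
polymers (the `{Y_δ}`, activities `w`) not overlapping `D`, of `Π_{X∈D} wQ X · Π_{Y∈A} w Y`. [cite: BalabanImbrieJaffe1988, (5.14.5) p.312] -/
def obsNumerator (𝒟 : Finset (Finset Q)) (wQ : Q → ℂ) (w : P → ℂ) (Λ : Finset P) : ℂ :=
  ∑ D ∈ 𝒟, ∑ A ∈ Λ.powerset,
    if IsCompatible inc A ∧ (∀ X ∈ D, ∀ Y ∈ A, ¬ incQ X Y) then (∏ X ∈ D, wQ X) * ∏ Y ∈ A, w Y else 0

variable {inc incQ}

/-- the inner sum over vacuum families compatible with `D` is the vacuum partition function of `Λ ∖ N(D)`.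
[cite: BalabanImbrieJaffe1988, (5.14.5) p.312] -/
theorem sum_vacuum_eq (D : Finset Q) (w : P → ℂ) (Λ : Finset P) :
    (∑ A ∈ Λ.powerset, if IsCompatible inc A ∧ (∀ X ∈ D, ∀ Y ∈ A, ¬ incQ X Y) then ∏ Y ∈ A, w Y else 0) =
      polymerPartitionFunction inc w (avoid incQ Λ D) := by
  rw [polymerPartitionFunction]
  -- the families `A ⊆ Λ` compatible with `D` are exactly the subsets of `avoid Λ D`
  have hpow : (avoid incQ Λ D).powerset = Λ.powerset.filter fun A => ∀ X ∈ D, ∀ Y ∈ A, ¬ incQ X Y := by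
    ext A
    simp only [mem_powerset, mem_filter, subset_iff, mem_avoid]
    exact ⟨fun h => ⟨fun Y hY => (h hY).1, fun X hX Y hY => (h hY).2 X hX⟩, fun h Y hY => ⟨h.1 hY, fun X hX => h.2 X hX Y hY⟩⟩
  rw [hpow, sum_filter]
  refine sum_congr rfl fun A _ => ?_
  by_cases hD : ∀ X ∈ D, ∀ Y ∈ A, ¬ incQ X Y
  · rw [if_pos hD]
    by_cases hc : IsCompatible inc A
    · rw [if_pos ⟨hc, hD⟩, if_pos hc]
    · rw [if_neg (fun h => hc h.1), if_neg hc]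
  · rw [if_neg hD, if_neg (fun h => hD h.2)]

/-- **the vacuum gas re-summed around each decorated family**: `obsNumerator = Σ_{D ∈ 𝒟} Π_{X∈D} wQ X · Z(Λ ∖ N(D))` (p. 310 [PDF 54]: the Y's
not joined to any X_γ *"factor out"*). [cite: BalabanImbrieJaffe1988, (5.14.5) p.312] -/
theorem obsNumerator_eq_sum_mul (𝒟 : Finset (Finset Q)) (wQ : Q → ℂ) (w : P → ℂ) (Λ : Finset P) :
    obsNumerator inc incQ 𝒟 wQ w Λ = ∑ D ∈ 𝒟, (∏ X ∈ D, wQ X) * polymerPartitionFunction inc w (avoid incQ Λ D) := by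
  unfold obsNumerator
  refine sum_congr rfl fun D _ => ?_
  rw [← sum_vacuum_eq D w Λ, mul_sum]
  refine sum_congr rfl fun A _ => ?_
  rw [mul_ite, mul_zero]

/-- without observables (`𝒟 = {∅}`) the numerator is the vacuum partition function `z = z_{F=1}` (p. 308 [PDF 52] *"where z(Λ₁₂^{(k)}) =
z_{F=1}(Λ₁₂^{(k)})"*). [cite: BalabanImbrieJaffe1988, (5.14.2) p.308] -/
theorem obsNumerator_singleton_empty (wQ : Q → ℂ) (w : P → ℂ) (Λ : Finset P) :
    obsNumerator inc incQ {∅} wQ w Λ = polymerPartitionFunction inc w Λ := by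
  rw [obsNumerator_eq_sum_mul, sum_singleton, prod_empty, one_mul, avoid_empty]

/-! ## §2 *"the polymer expansion u = 1 + a permits us to factor out the normalization"* — the ratio through clusters -/

/-- the clusters entering the exponent: `C ⊆ Λ` meets `N(D)` iff some member of `C` overlaps some member of `D`.
[cite: BalabanImbrieJaffe1988, (5.14.5) p.312] -/
theorem filter_inter_nbhd_nonempty_eq (Λ : Finset P) (D : Finset Q) :
    (Λ.powerset.filter fun C => (C ∩ nbhd incQ Λ D).Nonempty) =
      Λ.powerset.filter fun C => ∃ Y ∈ C, ∃ X ∈ D, incQ X Y := by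
  refine filter_congr fun C hC => ?_
  rw [mem_powerset] at hC
  constructor
  · rintro ⟨Y, hY⟩
    obtain ⟨hYC, hYN⟩ := mem_inter.1 hY
    exact ⟨Y, hYC, (mem_nbhd.1 hYN).2⟩
  · rintro ⟨Y, hYC, hX⟩
    exact ⟨Y, mem_inter.2 ⟨hYC, mem_nbhd.2 ⟨hC hYC, hX⟩⟩⟩

/-- **[KP86, (5)] for one decorated family**: in a Kotecký–Preiss volume `Λ`, `Z(Λ ∖ N(D))/Z(Λ) = exp(−Σ_{C ⊆ Λ, C overlapping D} Φ^T(C))` — the cost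
of excluding the vacuum polymers overlapping the `X_γ` is the exponential of (minus) the truncated functionals of the clusters meeting them (the
tree's `polymerPartitionFunction_sdiff_div_eq_exp`). [cite: BalabanImbrieJaffe1988, (5.14.5) p.312] -/
theorem avoid_div_eq_exp [Std.Refl inc] [Std.Symm inc] {w : P → ℂ} {a : P → ℝ} {Λ : Finset P} (hKP : IsKPVolume inc w a Λ)
    (D : Finset Q) :
    polymerPartitionFunction inc w (avoid incQ Λ D) / polymerPartitionFunction inc w Λ =
      Complex.exp (-∑ C ∈ Λ.powerset with (∃ Y ∈ C, ∃ X ∈ D, incQ X Y), truncatedWeight inc w C) := by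
  rw [avoid_eq_sdiff, polymerPartitionFunction_sdiff_div_eq_exp hKP, filter_inter_nbhd_nonempty_eq]

/-- **p. 312, *"the polymer expansion u = 1 + a permits us to factor out the normalization"***: in a Kotecký–Preiss volume the NORMALIZED
expectation with the observables inserted is `obsNumerator / Z(Λ) = Σ_{D ∈ 𝒟} Π_{X∈D} wQ X · exp(−Σ_{C ⊆ Λ, C overlapping D} Φ^T(C))`: each
decorated family is dressed by the clusters of vacuum polymers overlapping it, and the normalization `z` has cancelled.
[cite: BalabanImbrieJaffe1988, (5.14.5) p.312] -/
theorem obsRatio_eq_sum_mul_exp [Std.Refl inc] [Std.Symm inc] (𝒟 : Finset (Finset Q)) (wQ : Q → ℂ) {w : P → ℂ} {a : P → ℝ}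
    {Λ : Finset P} (hKP : IsKPVolume inc w a Λ) :
    obsNumerator inc incQ 𝒟 wQ w Λ / polymerPartitionFunction inc w Λ =
      ∑ D ∈ 𝒟, (∏ X ∈ D, wQ X) *
        Complex.exp (-∑ C ∈ Λ.powerset with (∃ Y ∈ C, ∃ X ∈ D, incQ X Y), truncatedWeight inc w C) := by
  rw [obsNumerator_eq_sum_mul, sum_div]
  refine sum_congr rfl fun D _ => ?_
  rw [mul_div_assoc, avoid_div_eq_exp hKP D]

/-- the same with the exponent restricted to CLUSTERS (connected families of vacuum polymers): `Φ^T(C) = 0` off clusters in a KP volume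
(`truncatedWeight_eq_zero_of_kp`, [KP86, Theorem]). [cite: BalabanImbrieJaffe1988, (5.14.5) p.312] -/
theorem obsRatio_eq_sum_mul_exp_clusters [DecidablePred (IsPolymerCluster inc)] [Std.Refl inc] [Std.Symm inc] (𝒟 : Finset (Finset Q)) (wQ : Q → ℂ) {w : P → ℂ} {a : P → ℝ}
    {Λ : Finset P} (hKP : IsKPVolume inc w a Λ) :
    obsNumerator inc incQ 𝒟 wQ w Λ / polymerPartitionFunction inc w Λ =
      ∑ D ∈ 𝒟, (∏ X ∈ D, wQ X) *
        Complex.exp (-∑ C ∈ Λ.powerset with (IsPolymerCluster inc C ∧ ∃ Y ∈ C, ∃ X ∈ D, incQ X Y), truncatedWeight inc w C) := by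
  rw [obsRatio_eq_sum_mul_exp 𝒟 wQ hKP]
  refine sum_congr rfl fun D _ => ?_
  congr 3
  rw [sum_filter, sum_filter]
  refine sum_congr rfl fun C hC => ?_
  by_cases hcl : IsPolymerCluster inc C
  · simp only [hcl, true_and]
  · have h0 : truncatedWeight inc w C = 0 := truncatedWeight_eq_zero_of_kp hKP (mem_powerset.1 hC) hcl
    simp [hcl, h0]

/-- the normalization is non-zero in a KP volume, so the ratio statements are not vacuous (`polymerPartitionFunction_ne_zero_of_kp`).
[cite: BalabanImbrieJaffe1988, (5.14.5) p.312] -/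
theorem vacuumZ_ne_zero [Std.Refl inc] [Std.Symm inc] {w : P → ℂ} {a : P → ℝ} {Λ : Finset P} (hKP : IsKPVolume inc w a Λ) :
    polymerPartitionFunction inc w Λ ≠ 0 :=
  polymerPartitionFunction_ne_zero_of_kp hKP subset_rfl

/-- hence the numerator itself: `obsNumerator = Z(Λ) · Σ_D Π wQ · exp(−Σ_{C overlapping D} Φ^T(C))`. [cite: BalabanImbrieJaffe1988, (5.14.5) p.312] -/
theorem obsNumerator_eq_Z_mul [Std.Refl inc] [Std.Symm inc] (𝒟 : Finset (Finset Q)) (wQ : Q → ℂ) {w : P → ℂ} {a : P → ℝ}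
    {Λ : Finset P} (hKP : IsKPVolume inc w a Λ) :
    obsNumerator inc incQ 𝒟 wQ w Λ = polymerPartitionFunction inc w Λ *
      ∑ D ∈ 𝒟, (∏ X ∈ D, wQ X) *
        Complex.exp (-∑ C ∈ Λ.powerset with (∃ Y ∈ C, ∃ X ∈ D, incQ X Y), truncatedWeight inc w C) := by
  rw [← obsRatio_eq_sum_mul_exp 𝒟 wQ hKP, mul_div_cancel₀ _ (vacuumZ_ne_zero hKP)]

end Literature.MathematicalPhysics.QuantumFieldTheory.BalabanImbrieJaffe1984to88.BIJ88ObservableGas312
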